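import Summits.ValiantsHypothesis.ValiantsHypothesis.Theorems.BarrierLeverChowBenchmarkPairsTropical
import Summits.ValiantsHypothesis.ValiantsHypothesis.Theorems.BarrierLeverChowBenchmarkPairsPeelIterate

/-!
# Route BarrierLever — item 22038 `ChowBenchmarkPairs`, line `moore-peel`: SYMBOLIC ITERATION of the TROPICAL peeling
# lemma — every tropically peelable column family is a GTN instance (a family strictly larger than `Peelable`)

Helper file (`--supports stmt-ValiantsHypothesis-22038`; cell valiant-natproofs, rung V4, 𝒟-side benchmark of record;
seat val-np-p4 gen 22).  Closes NO item.

CONJECTURE GTN (`…ChowBenchmarkPairsGTN.lean`, registered `stub_gtn`): for every column family through `∅` some table makes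
the segment-moment matrix (rows = all subsets of size `≤ 2` of the points) nonsingular.  `…PeelIterate.lean` proved it for the
RIGIDLY peelable families (`Peelable`: adjoin a set `A` met by no old column together with the `n+1` columns above it).  THIS
FILE iterates the tropical (weighted one-point) peeling lemma `det_symbMatrixW_ne_zero` (`…Tropical.lean`) instead:

* `TropPeelable n T` (inductive) — the empty family, and one TROPICAL step: a weight `w : κ → ℕ` and a threshold `lam` such
  that every old column has weight `< lam`, the `n+1` new columns have weight `≥ lam` (a strict superlevel set of the weight),
  their zero-weight parts («traces» `ztrace w (U j)`) are pairwise distinct, and the column at the row `{new}` has trace `∅`.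
  `Peelable.tropPeelable`: the rigid step is the case `w = 𝟙_A`, `lam = |A|` (`wdeg_indicator_lt_iff`,
  `le_wdeg_indicator_iff`, `ztrace_indicator`), so `Peelable n T → TropPeelable n T`.
* `det_genTable_ne_zero_of_tropPeelable` — the generic determinant of a tropically peelable family is a nonzero polynomial.
  Induction as in `…PeelIterate.lean`; the block hypothesis `hZ` of the tropical lemma is discharged by EVALUATING the generic
  table at the 0/1 «trace table» (old point `a` ↦ indicator of `ztrace w (U (some a))`, new point ↦ indicator of the
  positive-weight coordinates, `trTable` / `posPt`): there the block `zEntryW` is inclusion-triangular,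
  `zEntryW_trTable : zEntryW … i (U j) = [Z_j ⊆ Z_i]·|Z_j|!·|U j ∖ Z_j|!` (`Z = ztrace w ∘ U`, `Z_none = ∅`), hence nonsingular by
  `det_subsetIndicator` (`det_zEntryW_trTable_ne_zero`); the algebra map `X_{(last,c)} ↦ X_{(last,c)}·x^{w c}` carries the
  generic determinant of `n+1` points onto the symbolic tropical determinant (`det_finTable`).
* `exists_table_of_tropPeelable`, `exists_table_of_tropPeelable_enum` — hence some complex table is nonsingular; the second
  form is the conclusion of `ChowBenchmarkGTN.Stmt.gtn` verbatim (rows enumerated by `u`).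

HOW MUCH LARGER (seat census over ALL admissible families — injective, through `∅`, at most `n` singleton columns —, folder
num/peelcmp.py, weights searched up to 3–4): (points, coordinates) = (2,3): 34 admissible, 30 rigidly peelable, 31 tropically
peelable (the new one is `{∅, {0,1}, {0,2}, {1,2}}`: weights `(2,1,0)`, threshold `2`, traces `∅, {2}`); (3,4): 4 950 / 3 048
(62 %) / 3 965 (80 %); (4,4): 3 003 / 1 369 (46 %) / ≥ 1 739 (58 %).  GTN predicts 100 % (0 exceptions in the censuses of record).
LIMIT OF THE METHOD: a one-point toric degeneration `q·x^w` exposes a single Laplace term only when the new columns form a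
strict superlevel set of the weight with pairwise distinct traces; for a DOWN-SET family every nonempty weight class contains
its own base (trace `∅`), so at most one class can be used, and the 5-point cube `W_5 = 2^[4]` (16 columns) admits no such
step at all — the benchmark window `W_h` is not reached beyond the rigid heights `h ∈ {1,2,3,4,8}` (memo
HOME/val-np-p4/g22/MEMO-tropical-peeling-and-collisions-valnp4-g22.md).

WHAT THIS IS NOT: no stub of the line is closed; nothing on crux stmt-ValiantsHypothesis-14610 or on `VP` versus `VNP`.
-/

set_option linter.dupNamespace false

namespace Summit.ValiantsHypothesis.ValiantsHypothesis.Theorems.BarrierLever.ChowBenchmarkPeel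

open Finset

variable {κ : Type*} [DecidableEq κ]
variable {R : Type*} [CommRing R] {n : ℕ}

/-! ## 4. Tropically peelable column families are GTN instances (symbolic iteration) -/

section IterateW

/-- For the indicator weight the zero-weight part of a column is `T ∖ A`. -/
theorem ztrace_indicator (A T : Finset κ) : ztrace (fun c => if c ∈ A then 1 else 0) T = T \ A := by
  ext c
  simp [ztrace, Finset.mem_sdiff]

/-- **Tropically peelable column families** (indexed by the rows `Row n`): the empty family at `n = 0`, and one tropical
peeling step — a weight `w : κ → ℕ` and a threshold `lam` with every old column of weight `< lam`, `n+1` new columns of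
weight `≥ lam` whose zero-weight parts are pairwise distinct, the one at the row `{new}` having zero-weight part `∅`; the
enlarged family is re-indexed by `Row (n+1)` through `rowEquiv`. -/
inductive TropPeelable : (n : ℕ) → (Row n → Finset κ) → Prop
  | zero (T : Row 0 → Finset κ) (hT : ∀ S, T S = ∅) : TropPeelable 0 T
  | step {n : ℕ} {T : Row n → Finset κ} (w : κ → ℕ) (lam : ℕ) (U : Option (Fin n) → Finset κ)
      (hT : TropPeelable n T) (hlt : ∀ S, wdeg w (T S) < lam) (hle : ∀ j, lam ≤ wdeg w (U j))
      (hU0 : ztrace w (U none) = ∅) (hinj : Function.Injective fun j => ztrace w (U j)) :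
      TropPeelable (n + 1) (fun S => Sum.elim T U ((rowEquiv n).symm S))

/-- **Rigid peeling is the special case `w = 𝟙_A`, `lam = |A|`:** every rigidly peelable family is tropically peelable. -/
theorem Peelable.tropPeelable {n : ℕ} {T : Row n → Finset κ} (h : Peelable n T) : TropPeelable n T := by
  induction h with
  | zero T hT => exact TropPeelable.zero T hT
  | @step n T A U hT hA hUA hU0 hU ih =>
    refine TropPeelable.step (fun c => if c ∈ A then 1 else 0) A.card U ih ?_ ?_ ?_ ?_
    · intro S
      exact (wdeg_indicator_lt_iff A (T S)).mpr (hA S)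
    · intro j
      exact (le_wdeg_indicator_iff A (U j)).mpr (hUA j)
    · rw [ztrace_indicator, hU0, Finset.sdiff_self]
    · intro j j' e
      simp only [ztrace_indicator] at e
      apply hU
      have := congrArg (fun S => S ∪ A) e
      simp only [Finset.sdiff_union_of_subset (hUA j), Finset.sdiff_union_of_subset (hUA j')] at this
      exact this

/-- The 0/1 table of zero-weight parts: `P a c = [c ∈ ztrace w (U (some a))]`. -/
def trTable (w : κ → ℕ) (U : Option (Fin n) → Finset κ) : Fin n → κ → ℂ :=
  fun a c => if c ∈ ztrace w (U (some a)) then 1 else 0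

/-- The indicator point of the positive-weight coordinates. -/
def posPt (w : κ → ℕ) : κ → ℂ := fun c => if w c = 0 then 0 else 1

omit [DecidableEq κ] in
/-- A monomial of the positive indicator point: `∏_{c∈T} posPt w c = [no zero-weight coordinate in T]`. -/
theorem prod_posPt (w : κ → ℕ) (T : Finset κ) :
    (∏ c ∈ T, posPt w c) = if (∀ c ∈ T, w c ≠ 0) then (1 : ℂ) else 0 := by
  by_cases h : ∀ c ∈ T, w c ≠ 0
  · rw [if_pos h]
    exact Finset.prod_eq_one fun c hc => by unfold posPt; rw [if_neg (h c hc)]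
  · rw [if_neg h]
    obtain ⟨c, hc⟩ := not_forall.mp h
    obtain ⟨hcT, hw⟩ := Classical.not_imp.mp hc
    exact Finset.prod_eq_zero hcT (by unfold posPt; rw [if_pos (not_not.mp hw)])

/-- **The block `zEntryW` at the trace table / positive point is inclusion-triangular**:
`zEntryW (trTable w U) (posPt w) w i (U j) = [Z_j ⊆ Z_i] · |Z_j|!·|U j ∖ Z_j|!` with `Z_j = ztrace w (U j)` (and
`Z_none = ∅`). -/
theorem zEntryW_trTable (w : κ → ℕ) (U : Option (Fin n) → Finset κ) (hU0 : ztrace w (U none) = ∅)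
    (i j : Option (Fin n)) :
    zEntryW (trTable w U) (posPt w) w i (U j) =
      if ztrace w (U j) ⊆ ztrace w (U i) then
        (((ztrace w (U j)).card.factorial * ((U j) \ ztrace w (U j)).card.factorial : ℕ) : ℂ) else 0 := by
  have key : ∀ T : Finset κ, (∀ c ∈ T, w c ≠ 0) ↔ ztrace w T = ∅ := by
    intro T
    rw [ztrace, Finset.filter_eq_empty_iff]
  cases i with
  | none =>
    rw [zEntryW, prod_posPt, hU0]
    by_cases h : ztrace w (U j) = ∅
    · rw [if_pos ((key _).mpr h), if_pos (Finset.subset_empty.mpr h), h, Finset.card_empty, Nat.factorial_zero,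
        one_mul, Finset.sdiff_empty, mul_one]
    · rw [if_neg (fun h' => h ((key _).mp h')), if_neg (fun h' => h (Finset.subset_empty.mp h')), mul_zero]
  | some a =>
    rw [zEntryW, starW]
    set Z := ztrace w (U j) with hZ
    have hZU : Z ⊆ U j := Finset.filter_subset _ _
    rw [Finset.sum_eq_single Z]
    · rw [prod_posPt]
      have h1 : ∀ c ∈ U j \ Z, w c ≠ 0 := by
        intro c hc
        rw [Finset.mem_sdiff] at hc
        intro h0
        exact hc.2 (Finset.mem_filter.mpr ⟨hc.1, h0⟩)
      rw [if_pos h1, mul_one]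
      unfold trTable
      rw [Finset.prod_boole]
      by_cases h : Z ⊆ ztrace w (U (some a))
      · rw [if_pos (fun c hc => h hc), if_pos h, mul_one, Nat.cast_mul]
      · rw [if_neg (fun h' => h (fun c hc => h' c hc)), if_neg h, mul_zero]
    · intro d hd hne
      have hdZ : d ⊆ Z := Finset.mem_powerset.mp hd
      -- some zero-weight coordinate of `U j` lies outside `d`
      obtain ⟨c, hcZ, hcd⟩ : ∃ c ∈ Z, c ∉ d :=
        Finset.exists_of_ssubset (Finset.ssubset_iff_subset_ne.mpr ⟨hdZ, hne⟩)
      have hc : c ∈ U j \ d := Finset.mem_sdiff.mpr ⟨hZU hcZ, hcd⟩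
      have hw : posPt w c = 0 := by
        unfold posPt
        rw [if_pos (Finset.mem_filter.mp hcZ).2]
      rw [Finset.prod_eq_zero hc hw, mul_zero]
    · intro h
      exact absurd (Finset.mem_powerset.mpr (Finset.Subset.refl _)) h

/-- Hence the block hypothesis of the tropical lemma holds at the trace table. -/
theorem det_zEntryW_trTable_ne_zero (w : κ → ℕ) (U : Option (Fin n) → Finset κ) (hU0 : ztrace w (U none) = ∅)
    (hinj : Function.Injective fun j => ztrace w (U j)) :
    (Matrix.of fun i j : Option (Fin n) => zEntryW (trTable w U) (posPt w) w i (U j)).det ≠ 0 := by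
  have e : (Matrix.of fun i j : Option (Fin n) => zEntryW (trTable w U) (posPt w) w i (U j)) =
      Matrix.of fun i j : Option (Fin n) => if (fun j => ztrace w (U j)) j ⊆ (fun j => ztrace w (U j)) i then
        (((ztrace w (U j)).card.factorial * ((U j) \ ztrace w (U j)).card.factorial : ℕ) : ℂ) else 0 := by
    ext i j
    rw [Matrix.of_apply, Matrix.of_apply, zEntryW_trTable w U hU0]
  rw [e, det_subsetIndicator (fun j => ztrace w (U j)) hinj, Finset.prod_ne_zero_iff]
  intro j _
  exact Nat.cast_ne_zero.mpr (Nat.mul_ne_zero (Nat.factorial_ne_zero _) (Nat.factorial_ne_zero _))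

/-- Ring homomorphisms act on `starW` entrywise. -/
theorem map_starW {R' : Type*} [CommRing R'] (f : R →+* R') (P : Fin n → κ → R) (a : Fin n) (q : κ → R)
    (w : κ → ℕ) (T : Finset κ) :
    f (starW P a q w T) = starW (fun a c => f (P a c)) a (fun c => f (q c)) w T := by
  unfold starW
  rw [map_sum]
  refine Finset.sum_congr rfl fun d _ => ?_
  rw [map_mul, map_mul, map_mul, map_natCast, map_natCast, map_prod, map_prod]

/-- Ring homomorphisms act on `zEntryW` entrywise. -/
theorem map_zEntryW {R₁ R₂ : Type*} [CommRing R₁] [IsDomain R₁] [CommRing R₂] [IsDomain R₂] (f : R₁ →+* R₂)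
    (P : Fin n → κ → R₁) (q : κ → R₁) (w : κ → ℕ) (i : Option (Fin n)) (T : Finset κ) :
    f (zEntryW P q w i T) = zEntryW (fun a c => f (P a c)) (fun c => f (q c)) w i T := by
  cases i with
  | none => rw [zEntryW, zEntryW, map_mul, map_natCast, map_prod]
  | some a => rw [zEntryW, zEntryW, map_starW]

/-- **The generic determinant of a tropically peelable family is a nonzero polynomial.** -/
theorem det_genTable_ne_zero_of_tropPeelable {n : ℕ} {T : Row n → Finset κ} (h : TropPeelable n T) :
    (Matrix.of fun S S' : Row n => segE (genTable n) S.1 (T S')).det ≠ 0 := by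
  classical
  induction h with
  | zero T hT => exact det_genTable_ne_zero (Peelable.zero T hT)
  | @step n T w lam U hT hlt hle hU0 hinj ih =>
    set Rn := MvPolynomial (Fin n × κ) ℂ
    set R := MvPolynomial (Fin (n + 1) × κ) ℂ with hR
    let old : Fin n → κ → R := fun a c => MvPolynomial.X (Fin.castSucc a, c)
    let q : κ → R := fun c => MvPolynomial.X (Fin.last n, c)
    -- (i) the old matrix is nonsingular in `R`
    let ι : Fin n × κ → Fin (n + 1) × κ := Prod.map Fin.castSucc id
    have hι : Function.Injective ι := (Fin.castSucc_injective n).prodMap Function.injective_id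
    have hold : (Matrix.of fun S S' : Row n => segE old S.1 (T S')).det ≠ 0 := by
      have e : (Matrix.of fun S S' : Row n => segE old S.1 (T S')) =
          (MvPolynomial.rename ι : Rn →ₐ[ℂ] R).toRingHom.mapMatrix
            (Matrix.of fun S S' : Row n => segE (genTable n) S.1 (T S')) := by
        refine Matrix.ext fun S S' => ?_
        rw [RingHom.mapMatrix_apply, Matrix.map_apply, Matrix.of_apply, Matrix.of_apply,
          map_segE (MvPolynomial.rename ι : Rn →ₐ[ℂ] R).toRingHom]
        congr 1
        funext a c
        show MvPolynomial.X (Fin.castSucc a, c) = MvPolynomial.rename ι (MvPolynomial.X (a, c))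
        rw [MvPolynomial.rename_X]
        rfl
      rw [e, ← RingHom.map_det]
      intro h0
      apply ih
      apply MvPolynomial.rename_injective ι hι
      rw [map_zero]
      exact h0
    -- (ii) the block `zEntryW` is nonsingular in `R`: evaluate at the trace table / positive indicator point
    let g : Fin (n + 1) × κ → ℂ := fun p =>
      match finSuccEquivLast p.1 with
      | none => posPt w p.2
      | some i => trTable w U i p.2
    have hgold : (fun a c => MvPolynomial.eval g (old a c)) = trTable w U := by
      funext a c
      simp [old, g, MvPolynomial.eval_X, finSuccEquivLast_castSucc]
    have hgq : (fun c => MvPolynomial.eval g (q c)) = posPt w := by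
      funext c
      simp [q, g, MvPolynomial.eval_X, finSuccEquivLast_last]
    have hZ : (Matrix.of fun i j : Option (Fin n) => zEntryW old q w i (U j)).det ≠ 0 := by
      intro h0
      have h1 := congrArg (MvPolynomial.eval g) h0
      rw [RingHom.map_det, map_zero] at h1
      have e : (MvPolynomial.eval g).mapMatrix (Matrix.of fun i j : Option (Fin n) => zEntryW old q w i (U j)) =
          Matrix.of fun i j : Option (Fin n) => zEntryW (trTable w U) (posPt w) w i (U j) := by
        refine Matrix.ext fun i j => ?_
        rw [RingHom.mapMatrix_apply, Matrix.map_apply, Matrix.of_apply, Matrix.of_apply, map_zEntryW, hgold, hgq]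
      rw [e] at h1
      exact det_zEntryW_trTable_ne_zero w U hU0 hinj h1
    -- (iii) the tropical peeling lemma
    have hsymb := det_symbMatrixW_ne_zero old q w T U lam hlt hle hold hZ
    -- (iv) the monomial substitution `X_{(last,c)} ↦ X_{(last,c)} · x^{w c}`
    let ψ : R →ₐ[ℂ] Polynomial R := MvPolynomial.aeval fun p : Fin (n + 1) × κ =>
      if p.1 = Fin.last n then Polynomial.C (MvPolynomial.X p) * Polynomial.X ^ (w p.2)
      else Polynomial.C (MvPolynomial.X p)
    have hψX : ∀ (a : Fin (n + 1)) (c : κ), ψ (genTable (n + 1) a c) =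
        if a = Fin.last n then Polynomial.C (MvPolynomial.X (a, c)) * Polynomial.X ^ (w c)
        else Polynomial.C (MvPolynomial.X (a, c)) :=
      fun a c => MvPolynomial.aeval_X _ _
    have hψtab : (fun a c => ψ (genTable (n + 1) a c)) = finTable (symbTableW old q w) := by
      funext a c
      rw [hψX]
      induction a using Fin.lastCases with
      | last =>
        rw [finTable_last, if_pos rfl]
        rfl
      | cast i =>
        rw [finTable_castSucc, if_neg (Fin.castSucc_lt_last i).ne]
        rfl
    intro h0
    have h1 := congrArg ψ.toRingHom h0
    rw [map_zero, RingHom.map_det] at h1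
    have e : ψ.toRingHom.mapMatrix (Matrix.of fun S S' : Row (n + 1) =>
        segE (genTable (n + 1)) S.1 (Sum.elim T U ((rowEquiv n).symm S'))) =
        Matrix.of fun S S' : Row (n + 1) =>
          segE (finTable (symbTableW old q w)) S.1 (Sum.elim T U ((rowEquiv n).symm S')) := by
      refine Matrix.ext fun S S' => ?_
      rw [RingHom.mapMatrix_apply, Matrix.map_apply, Matrix.of_apply, Matrix.of_apply, map_segE, ← hψtab]
      rfl
    rw [e, det_finTable] at h1
    exact hsymb h1

/-- **Every tropically peelable column family is a GTN instance.** -/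
theorem exists_table_of_tropPeelable {n : ℕ} {T : Row n → Finset κ} (h : TropPeelable n T) :
    ∃ P : Fin n → κ → ℂ, (Matrix.of fun S S' : Row n => segE P S.1 (T S')).det ≠ 0 := by
  classical
  by_contra hall
  simp only [not_exists, not_not] at hall
  apply det_genTable_ne_zero_of_tropPeelable h
  apply MvPolynomial.funext
  intro x
  rw [map_zero, RingHom.map_det]
  have e : (MvPolynomial.eval x).mapMatrix (Matrix.of fun S S' : Row n => segE (genTable n) S.1 (T S')) =
      Matrix.of fun S S' : Row n => segE (fun a c => x (a, c)) S.1 (T S') := by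
    refine Matrix.ext fun S S' => ?_
    rw [RingHom.mapMatrix_apply, Matrix.map_apply, Matrix.of_apply, Matrix.of_apply, map_segE]
    congr 1
    funext a c
    simp [genTable]
  rw [e]
  exact hall _

/-- **GTN for tropically peelable families, in the node's frame** (`ChowBenchmarkGTN.Stmt.gtn`, entry verbatim). -/
theorem exists_table_of_tropPeelable_enum {h r : ℕ} (u : Fin r → Finset (Fin h)) (hu : Function.Injective u)
    (hcard : ∀ i, (u i).card ≤ 2) (hsurj : ∀ S : Finset (Fin h), S.card ≤ 2 → ∃ i, u i = S)
    (T : Fin r → Finset (Fin h)) (hT : TropPeelable h (fun S => T ((rowIndex u hu hcard hsurj).symm S))) :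
    ∃ P : Fin h → Fin h → ℂ,
      (Matrix.of fun i j : Fin r =>
        ∑ g : (↥(T j) → ↥(u i)), (∏ c : ↥(T j), P (g c) c) *
          ∏ a : ↥(u i), ((Finset.univ.filter fun c : ↥(T j) => g c = a).card.factorial : ℂ)).det ≠ 0 := by
  obtain ⟨P, hP⟩ := exists_table_of_tropPeelable hT
  refine ⟨P, ?_⟩
  set σ := rowIndex u hu hcard hsurj with hσ
  have hval : ∀ i, (σ i).1 = u i := fun i => rfl
  have e : (Matrix.of fun S S' : Row h => segE P S.1 (T (σ.symm S'))) =
      Matrix.reindex σ σ (Matrix.of fun i j : Fin r => segE P (u i) (T j)) := by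
    refine Matrix.ext fun S S' => ?_
    rw [Matrix.reindex_apply, Matrix.submatrix_apply, Matrix.of_apply, Matrix.of_apply, ← hval (σ.symm S),
      Equiv.apply_symm_apply]
  rw [e, Matrix.det_reindex_self] at hP
  exact hP

end IterateW

end Summit.ValiantsHypothesis.ValiantsHypothesis.Theorems.BarrierLever.ChowBenchmarkPeel
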